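import Summits.BirchSwinnertonDyer.Rank1Residual.Additive.TameBranchUpperOfRatDvd
import Summits.BirchSwinnertonDyer.Rank1Residual.Additive.PlusSymbolsPIntegralOfIrreducible
import HarnessLib

/-!
# T1 JOINED with the census tuple: the UPPER `T = 0` half on the X4-3 locus (e ∈ {3,4,6}, `p ≥ 5`)
# from Delbourgo 2002 (A)+(C), the census ordinary-twist-partner input, `μ^alg = 0` and the unit
# period binder — with `PlusSymbolsPIntegralAt` DISCHARGED on X4 (irreducible `E[p]`) — and the
# composed `BSD(E,p)` END at `r_an = 0`, `ord_p #Ш_an = 0` (route planner 2 ST-27.2 / READING A-UP;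
# team n1011; lane CLASS-CLOSURE, seat cc-typer-2 = typer of record N10 §3.2 / O7 §3.3)

HONEST FRAMING (cell `b2b-bsdres`, run/shared/lean/b2b/bsd-rank1-residual/, verbatim in every
file): the goal of the cell is to DELETE the COMBINATION-SHAPED residual classes of the
Birch–Swinnerton-Dyer formula for ALL analytic-rank `≤ 1` elliptic curves over `ℚ` — "full BSD
formula for every rank `≤ 1` curve in class `C`" assembled STRICTLY from published theorems — so
that the rank-`≤ 1` remainder becomes exactly the CONSTRUCTION-SHAPED classes, which are TYPED
(missing-input `Prop`s), NOT attempted. This is not "finishing BSD". Lane CLASS-CLOSURE: prove what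
is provable now; shrink each hard class to its core with data; no claim beyond stated classes;
census / instrument output = EVIDENCE, never a Literature fact; RESIDUAL-MAP marks N10 / N11 / O7
UNCHANGED; nothing is booked by this file. THEOREMS ONLY: 0 definitions, 0 named facts.

## What

`TameBranchCensusJoin.cycLeadingTermAt_of_tameBranchRatCharEq_of_ordinaryTwistPartnerAt` instantiates
the CONJECTURED rational main conjecture `TameBranchRatCharEqAt` on the tuple `(ι∘χ, ã, B)` supplied
by the census X4-3 input `CensusX43.OrdinaryTwistPartnerAt W p` (`TameBranchTeichmuller`,
`exists_isTameBranchOf_of_ordinaryTwistPartnerAt`: `‖ã‖ = 1`, `orderOf = tameDefect`, `B` integral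
as soon as the plus symbols are). This file replaces the conjecture by the TYPED / PRINTED Kato half
(T1 of `TameBranchUpperOfRatDvd`): on the X4-3 locus (`p ≥ 5`, additive, `SubGord`, `e ∈ {3,4,6}`)

* §1 `cycLeadingTermAt_of_tameBranchRatDvdAt_of_ordinaryTwistPartnerAt_of_hasUnitContent` /
  `…_of_mu_zero`: `TameBranchRatDvdAt W p` + `OrdinaryTwistPartnerAt W p` + `PlusSymbolsPIntegralAt W p`
  + `μ^alg = 0` (unit-content generators, resp. `D.mu = 0` for every cyclotomic datum) + the unit
  period binder `[0]⁺_f = u · L(E,1)/Ω_E` ⟹ `CycLeadingTermAt W p`;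
* §2 on X4♯(G-ord) the integrality input is a THEOREM (`plusSymbolsPIntegralAt_of_classX4`, p09-g2)
  and the Kato half is Delbourgo 2002 (A)+(C) (`tameBranchRatDvdAt_of_thmC`, non-CM):
  `ClassX4Gord.cycLeadingTermAt_e346_of_thmC_of_ordinaryTwistPartnerAt_of_mu_zero` and the END
  `ClassX4Gord.bsdp_rankZero_e346_of_thmC_of_ordinaryTwistPartnerAt_of_mu_zero_of_shaAn_unit` —
  binders: PRINTED {`hC`, `hDelA`, `hDelM`, `hDel`, `hGZK`, `hmod`} · class columns {`hX`, `hp5`,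
  `hcm`, `hr`, `he`} · census EVIDENCE {`h : OrdinaryTwistPartnerAt`, `hχ` (the character is
  `ι∘ω^{t(E,p)}`)} · μ-ANCHOR {`hμ0`} · period binder {`hq`, `hu`} (Birch × Pal / Manin, X41) · `#Ш_an`
  unit {`hs`, `hv`}. = r2's ANCHORED-PENDING e346 row shape {I1, I2, T1, T2, T3, F4} with I2 and
  T1 THEOREMS and the tuple supplied: what remains per row is the μ-anchor (I1 link certificate + T2
  + T3 + F4), the census tuple certificate, the period binder and `#Ш_an`.

What is NOT claimed: `μ = 0` on any row; the census input (EVIDENCE / instrument tier); anything on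
X3 rows (there `PlusSymbolsPIntegralAt` is a per-pair check and the tuple may fail — X4-3's five
`p`-isogeny rows); X4♯(G-ord) stays CONSTRUCTION-SHAPED; nothing booked.

References: D. Delbourgo, J. Number Theory 95 (2002) Thm. (A), (C) [Delbourgo2002]; Compositio 113
(1998) Prop. 4, Main Conjecture p. 151 [Delbourgo1998]; B. Mazur, J. Tate, J. Teitelbaum, Invent.
Math. 84 (1986) §I.13–14 [MazurTateTeitelbaum1986Invent]; L. Washington, GTM 83 §13.2 [Washington1997].
-/

set_option autoImplicit false

noncomputable section

open scoped Classical MatrixGroups ModularForm NumberField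

open CongruenceSubgroup WeierstrassCurve NumberField Literature.NumberTheory.EllipticCurves
  Literature.NumberTheory.EllipticCurves.ModularForms
  Literature.NumberTheory.EllipticCurves.Rank1Residual
  Literature.NumberTheory.EllipticCurves.Rank1Residual.Typed
  Literature.NumberTheory.EllipticCurves.Delbourgo2002
  Literature.NumberTheory.EllipticCurves.GreenbergVatsal2000
  IsDedekindDomain

namespace Summit.BirchSwinnertonDyer.Rank1Residual.Additive

variable (W : WeierstrassCurve ℚ) [W.IsElliptic] [W.IsGloballyMinimal] (p : ℕ) [hp : Fact p.Prime]

/-! ### §1 T1 on the census tuple -/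

/-- **UPPER chain on X4-3 from the TYPED Kato half** (the `TameBranchRatDvdAt` sibling of
`cycLeadingTermAt_of_tameBranchRatCharEq_of_ordinaryTwistPartnerAt`, binder-for-binder with `hT`
weakened and the main conjecture NOT assumed): `TameBranchRatDvdAt W p` + the census input
`OrdinaryTwistPartnerAt W p` (tuple `(ι∘χ, ã, B)`, `χ = ω^{t(E,p)}`) + `PlusSymbolsPIntegralAt W p`
(so `B` is integral) + `μ^alg = 0` as unit-content generators + the unit period binder
`[0]⁺_f = u · q`, `L(E,1) = q · Ω_E` ⟹ `CycLeadingTermAt W p`. Nothing asserted; nothing booked.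
[cite: Delbourgo2002, Theorem (C) (p. 40)] [cite: MazurTateTeitelbaum1986Invent, §I.13–I.14] -/
theorem cycLeadingTermAt_of_tameBranchRatDvdAt_of_ordinaryTwistPartnerAt_of_hasUnitContent
    (hT : TameBranchRatDvdAt W p) (h : CensusX43.OrdinaryTwistPartnerAt W p)
    (hPI : PlusSymbolsPIntegralAt W p) (h5 : 5 ≤ p) (hadd : Addv W p) (hG : SubGord W p)
    (he : semistabilityIndex W p ∈ ({3, 4, 6} : Finset ℕ))
    {N : ℕ} [NeZero N] {f : CuspForm (Gamma0 N) 2} (hf : IsNewformOf W f)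
    {χ : MulChar (ZMod p) ℚ_[p]}
    (hχ : CensusX43.IsTeichmullerPow χ (CensusX43.ordinaryTeichmullerExponent W p))
    (hμ : ∀ (K : ZpExtension ℚ p) (γ : Field.absoluteGaloisGroup ℚ),
      K.IsCyclotomic → K.IsTopGenerator γ → IsCyclotomicVariable p γ →
      ∀ (D : W.SelmerDualData K γ) (g : IwasawaAlgebra p), D.charIdeal = Ideal.span {g} →
        HasUnitContent g)
    {q : ℚ} (hq : W.entireLFunction 1 = (q : ℂ) * (W.realPeriodRat : ℂ))
    {u : ℤ_[p]ˣ} (hu : ((ratPlusSymbol f 0 : ℚ) : ℚ_[p]) = ((u : ℤ_[p]) : ℚ_[p]) * (q : ℚ_[p])) :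
    CycLeadingTermAt W p := by
  obtain ⟨ã, B, hã, hord, hB, hint⟩ :=
    exists_isTameBranchOf_of_ordinaryTwistPartnerAt W p h5 hG he h hf hχ
  have hp2 : p ≠ 2 := by omega
  have hne2 : semistabilityIndex W p ≠ 2 := by
    simp only [Finset.mem_insert, Finset.mem_singleton] at he
    omega
  have hGord : TypeGOrd W p :=
    (typeGOrd_iff_typeG_of_semistabilityIndex_ne_two W p h5 hadd hne2).mpr
      ((subGord_iff_typeG_of_addv W p hp2 hadd).mp hG)
  have hint1 : ∀ n : ℕ, ‖PowerSeries.coeff n B‖ ≤ 1 := hint 1 (hPI f hf)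
  have hãi : ‖ã⁻¹‖ = 1 := by rw [norm_inv, hã, inv_one]
  have hv : ã⁻¹ * ((ratPlusSymbol f 0 : ℚ) : ℚ_[p]) =
      (((PadicInt.mkUnits hãi * u : ℤ_[p]ˣ) : ℤ_[p]) : ℚ_[p]) * (q : ℚ_[p]) := by
    rw [hu, Units.val_mul, PadicInt.coe_mul, PadicInt.mkUnits_eq]
    ring
  exact cycLeadingTermAt_of_tameBranchRatDvdAt_of_hasUnitContent_of_integral hT hp2 hadd
    (Or.inr hGord) hf hord hã hB hμ hint1 hq hv

/-- **The same chain with the μ-ANCHOR in `SelmerDualData.mu` currency** (`D.mu = 0` for every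
cyclotomic datum — the output shape of the congruent-pair μ-transfer forms).
[cite: Delbourgo2002, Theorem (C) (p. 40)] [cite: MazurTateTeitelbaum1986Invent, §I.13–I.14] -/
theorem cycLeadingTermAt_of_tameBranchRatDvdAt_of_ordinaryTwistPartnerAt_of_mu_zero
    (hT : TameBranchRatDvdAt W p) (h : CensusX43.OrdinaryTwistPartnerAt W p)
    (hPI : PlusSymbolsPIntegralAt W p) (h5 : 5 ≤ p) (hadd : Addv W p) (hG : SubGord W p)
    (he : semistabilityIndex W p ∈ ({3, 4, 6} : Finset ℕ))
    {N : ℕ} [NeZero N] {f : CuspForm (Gamma0 N) 2} (hf : IsNewformOf W f)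
    {χ : MulChar (ZMod p) ℚ_[p]}
    (hχ : CensusX43.IsTeichmullerPow χ (CensusX43.ordinaryTeichmullerExponent W p))
    (hμ0 : ∀ (K : ZpExtension ℚ p) (γ : Field.absoluteGaloisGroup ℚ),
      K.IsCyclotomic → K.IsTopGenerator γ → IsCyclotomicVariable p γ →
      ∀ D : W.SelmerDualData K γ, D.IsTorsion → D.mu = 0)
    {q : ℚ} (hq : W.entireLFunction 1 = (q : ℂ) * (W.realPeriodRat : ℂ))
    {u : ℤ_[p]ˣ} (hu : ((ratPlusSymbol f 0 : ℚ) : ℚ_[p]) = ((u : ℤ_[p]) : ℚ_[p]) * (q : ℚ_[p])) :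
    CycLeadingTermAt W p := by
  obtain ⟨ã, B, hã, hord, hB, hint⟩ :=
    exists_isTameBranchOf_of_ordinaryTwistPartnerAt W p h5 hG he h hf hχ
  have hp2 : p ≠ 2 := by omega
  have hne2 : semistabilityIndex W p ≠ 2 := by
    simp only [Finset.mem_insert, Finset.mem_singleton] at he
    omega
  have hGord : TypeGOrd W p :=
    (typeGOrd_iff_typeG_of_semistabilityIndex_ne_two W p h5 hadd hne2).mpr
      ((subGord_iff_typeG_of_addv W p hp2 hadd).mp hG)
  have hint1 : ∀ n : ℕ, ‖PowerSeries.coeff n B‖ ≤ 1 := hint 1 (hPI f hf)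
  have hãi : ‖ã⁻¹‖ = 1 := by rw [norm_inv, hã, inv_one]
  have hv : ã⁻¹ * ((ratPlusSymbol f 0 : ℚ) : ℚ_[p]) =
      (((PadicInt.mkUnits hãi * u : ℤ_[p]ˣ) : ℤ_[p]) : ℚ_[p]) * (q : ℚ_[p]) := by
    rw [hu, Units.val_mul, PadicInt.coe_mul, PadicInt.mkUnits_eq]
    ring
  exact cycLeadingTermAt_of_tameBranchRatDvdAt_of_mu_zero_of_integral hT hp2 hadd (Or.inr hGord) hf
    hord hã hB hμ0 hint1 hq hv

/-! ### §2 X4♯(G-ord), e ∈ {3,4,6}: integrality DISCHARGED, Kato half PRINTED; the composed END -/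

variable {W p}

/-- `SubGord` from the (G-ord) class columns at `e ≠ 2` (bookkeeping: `TypeGOrd ⟹ TypeG ⟹ SubGord`
under additivity, `p ≥ 5`). [folklore] -/
theorem ClassX4Gord.subGord_of_semistabilityIndex_ne_two (hX : ClassX4Gord W p) (hp5 : 5 ≤ p)
    (hne2 : semistabilityIndex W p ≠ 2) : SubGord W p :=
  (subGord_iff_typeG_of_addv W p hX.addv.1 hX.addv.2).mpr
    ((typeGOrd_iff_typeG_of_semistabilityIndex_ne_two W p hp5 hX.addv.2 hne2).mp hX.typeGOrd)

/-- **X4♯(G-ord), `e ∈ {3,4,6}`, `p ≥ 5`, non-CM: `CycLeadingTermAt W p` from PRINTED facts + the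
census tuple + the μ-anchor + the unit period binder.** The Kato half is Delbourgo 2002 (A)+(C)
(`tameBranchRatDvdAt_of_thmC`), the integrality of `B` is the THEOREM `plusSymbolsPIntegralAt_of_classX4`
(irreducible `E[p]`); the remaining inputs are the census X4-3 input (`h`, `hχ` — EVIDENCE tier),
`μ(X(W/ℚ_∞)) = 0` for every cyclotomic datum (`hμ0`, the μ-ANCHOR), and `[0]⁺_f = u · L(E,1)/Ω_E`
(`hq`, `hu`). X4♯(G-ord) stays CONSTRUCTION-SHAPED; nothing booked.
[cite: Delbourgo2002, Theorem (A), (C) (p. 40)] [cite: Delbourgo1998, Main Conjecture (p. 151) (divisibility direction at `T = 0`; shape)] -/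
theorem ClassX4Gord.cycLeadingTermAt_e346_of_thmC_of_ordinaryTwistPartnerAt_of_mu_zero
    (hC : Delbourgo2002.thmC_charIdeal_dvd_tameBranch)
    (hDelA : Delbourgo2002.mainTheorem) (hDelM : Delbourgo2002.mainTheorem_potMult)
    (hX : ClassX4Gord W p) (hp5 : 5 ≤ p) (hcm : ¬ W.HasCM)
    (he : semistabilityIndex W p ∈ ({3, 4, 6} : Finset ℕ))
    (h : CensusX43.OrdinaryTwistPartnerAt W p)
    {N : ℕ} [NeZero N] {f : CuspForm (Gamma0 N) 2} (hf : IsNewformOf W f)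
    {χ : MulChar (ZMod p) ℚ_[p]}
    (hχ : CensusX43.IsTeichmullerPow χ (CensusX43.ordinaryTeichmullerExponent W p))
    (hμ0 : ∀ (K : ZpExtension ℚ p) (γ : Field.absoluteGaloisGroup ℚ),
      K.IsCyclotomic → K.IsTopGenerator γ → IsCyclotomicVariable p γ →
      ∀ D : W.SelmerDualData K γ, D.IsTorsion → D.mu = 0)
    {q : ℚ} (hq : W.entireLFunction 1 = (q : ℂ) * (W.realPeriodRat : ℂ))
    {u : ℤ_[p]ˣ} (hu : ((ratPlusSymbol f 0 : ℚ) : ℚ_[p]) = ((u : ℤ_[p]) : ℚ_[p]) * (q : ℚ_[p])) :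
    CycLeadingTermAt W p := by
  have hne2 : semistabilityIndex W p ≠ 2 := by
    simp only [Finset.mem_insert, Finset.mem_singleton] at he
    omega
  exact cycLeadingTermAt_of_tameBranchRatDvdAt_of_ordinaryTwistPartnerAt_of_mu_zero W p
    (tameBranchRatDvdAt_of_thmC hC hDelA hDelM hp5 hcm) h (plusSymbolsPIntegralAt_of_classX4 W p hX.1)
    hp5 hX.addv.2 (hX.subGord_of_semistabilityIndex_ne_two hp5 hne2) he hf hχ hμ0 hq hu

/-- **END — X4♯(G-ord), `e ∈ {3,4,6}`, `p ≥ 5`, non-CM, `r_an = 0`, `ord_p #Ш_an = 0`: `BSD(E,p)`.**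
Binders: PRINTED {`hC`, `hDelA`, `hDelM` (Delbourgo 2002 (C), (A), (A) on (M)), `hDel` (Delbourgo
1998 Prop. 4), `hGZK`, `hmod`} · class columns {`hX`, `hp5`, `hcm`, `hr`, `he`} · census EVIDENCE
{`h`, `hχ`} · μ-ANCHOR {`hμ0`} · period binder {`hq`, `hu`} · `#Ш_an` unit {`hs`, `hv`}. Through
`ClassX4Gord.bsdp_rankZero_of_cycLeadingTerm_of_shaAn_unit`. This is r2's ANCHORED-PENDING e346 row
END with I2 and T1 as theorems and the tuple supplied by X4-3; per row the instrument / prover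
columns left are the μ-anchor (KO link certificate + T2 + T3 + F4), the census tuple certificate,
Birch × Pal, and `#Ш_an`. Nothing booked; no mark moves. [cite: Delbourgo1998, Prop. 4 (p. 144)]
[cite: Delbourgo2002, Theorem (A), (C) (p. 40)] -/
theorem ClassX4Gord.bsdp_rankZero_e346_of_thmC_of_ordinaryTwistPartnerAt_of_mu_zero_of_shaAn_unit
    (hC : Delbourgo2002.thmC_charIdeal_dvd_tameBranch)
    (hDelA : Delbourgo2002.mainTheorem) (hDelM : Delbourgo2002.mainTheorem_potMult)
    (hDel : Delbourgo1998.prop4_rankZero_pow_dvd_constantCoeff)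
    (hGZK : rank_eq_analyticRank_of_analyticRank_le_one) (hmod : hasEntireLFunction_rat)
    (hX : ClassX4Gord W p) (hp5 : 5 ≤ p) (hcm : ¬ W.HasCM) (hr : W.analyticRank = 0)
    (he : semistabilityIndex W p ∈ ({3, 4, 6} : Finset ℕ))
    (h : CensusX43.OrdinaryTwistPartnerAt W p)
    {N : ℕ} [NeZero N] {f : CuspForm (Gamma0 N) 2} (hf : IsNewformOf W f)
    {χ : MulChar (ZMod p) ℚ_[p]}
    (hχ : CensusX43.IsTeichmullerPow χ (CensusX43.ordinaryTeichmullerExponent W p))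
    (hμ0 : ∀ (K : ZpExtension ℚ p) (γ : Field.absoluteGaloisGroup ℚ),
      K.IsCyclotomic → K.IsTopGenerator γ → IsCyclotomicVariable p γ →
      ∀ D : W.SelmerDualData K γ, D.IsTorsion → D.mu = 0)
    {q : ℚ} (hq : W.entireLFunction 1 = (q : ℂ) * (W.realPeriodRat : ℂ))
    {u : ℤ_[p]ˣ} (hu : ((ratPlusSymbol f 0 : ℚ) : ℚ_[p]) = ((u : ℤ_[p]) : ℚ_[p]) * (q : ℚ_[p]))
    {s : ℚ} (hs : shaAn W = (s : ℂ)) (hv : padicValRat p s = 0) : BSDp W p :=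
  ClassX4Gord.bsdp_rankZero_of_cycLeadingTerm_of_shaAn_unit hDel hGZK hmod hX hp5 hr
    (hX.cycLeadingTermAt_e346_of_thmC_of_ordinaryTwistPartnerAt_of_mu_zero hC hDelA hDelM hp5 hcm he h
      hf hχ hμ0 hq hu) hs hv

end Summit.BirchSwinnertonDyer.Rank1Residual.Additive

end
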